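import Mathlib.GroupTheory.DoubleCoset
import Literature.AnabelianGeometry.SemiGraphs.Coverticial
import Literature.AnabelianGeometry.SemiGraphs.FiniteEtaleCoveringGlobalDef

/-!
# Branches of a finite étale covering over a branch: the double-coset dictionary ((d) step 2)

Mochizuki, *Semi-graphs of anabelioids*, Publ. RIMS **42** (2006) 221–322, §2: Definition 2.2 (i),
p. 23 (finite étale coverings `𝒢' → 𝒢` attached to objects of `B(𝒢)`: "vertices (respectively,
edges) of `𝔾'` that lie over a vertex `v` (respectively, edge `e`) correspond to connected components
of `S_v` (respectively, `T_e`)"), Remark 2.2.1, p. 24 (images of `Π_v`, `Π_b` = stabilizers), and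
the use made of them in Remark 2.4.1, p. 26 ("one verifies easily that if `𝒢' → 𝒢` is a finite étale
covering … aloof … estranged") [cite: MochizukiSemiAnbd2006, Def. 2.2(i) p.23].

STATEMENTS ONLY (row G23 (d) step 2, L3-lead 22:23:57Z; proofs by the discharge seats).  Fix a finite
étale covering `φ : 𝒢' → 𝒢` attached to `A ∈ B(𝒢)` (`Hom.IsFiniteEtaleCoveringOf`, the LOCAL
description — which is all that is needed here, every statement below living at ONE vertex), a vertex
`v'` over `v`, basepoints `F'` of `𝒢'_{v'}` and `F` of `𝒢_v` with `β : φ_{v'}^* ⋙ F' ≅ F`, so that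
`ι := Aut(β) ∘ π₁(φ_{v'}) : Π_{v'} ↪ Π_v` (injective with image a point-stabilizer, L6-t17's
`FiniteEtaleLocalDictionary*`), and a branch `b` of `𝒢` abutting to `v` with representative
`Π_b = Π_b^{F_e, α} ⊆ Π_v`.  IMPLICIT IN PRINT (pp. 23–24, 26):

* `covering_branchFibre_doubleCosets` — for a branch-aligned covering (ruling μ2), the branches `b'` of `𝒢'` over `b` abutting to `v'` are in
  bijection with the double cosets `Π_{v'} \ Π_v / Π_b` (`b' ↦ Π_{v'} x_{b'} Π_b`), and for each such
  `b'` and each representative `Π_{b'} = Π_{b'}^{F'_e, α'} ⊆ Π_{v'}` there is an `x` in the double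
  coset of `b'` with `ι(Π_{b'}) = ι(Π_{v'}) ∩ x Π_b x⁻¹` — EQUALITY (not merely finite index, cf.
  L6-t17's `FiniteEtaleBranchImage`), which is what the clause "`b′ = b` and `g ∉ Π_{b′}`" of
  Definition 2.4 (iv) needs downstairs.

Consumers: clauses 3–4 (aloof, estranged) of `remark_2_4_1_covering` (`Coverticial.lean`) =
this dictionary + the group lemmas of `CoverticialCoveringGroupLemmas.lean` (L6-t17, p407702).
-/

namespace Literature.AnabelianGeometry.SemiGraphs

open CategoryTheory CategoryTheory.PreGaloisCategory
open Literature.AnabelianGeometry.Anabelioids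
open scoped Pointwise

universe v₁ u₁ u

namespace SemiGraphOfAnabelioids

/-- NAMED FACT (implicit in [SemiAnbd] Def. 2.2 (i) p. 23 / Rmk. 2.2.1 p. 24; used by Rmk. 2.4.1
p. 26): along the finite étale covering `φ : 𝒢' → 𝒢` attached to `A`, for a vertex `v'` over `v`
and a branch `b` abutting to `v`, the branches of `𝒢'` over `b` that abut to `v'` correspond
bijectively to the double cosets `Π_{v'} \ Π_v / Π_b`, and the branch group of such a `b'` maps, under
`ι : Π_{v'} ↪ Π_v`, ONTO `ι(Π_{v'}) ∩ x Π_b x⁻¹` for some `x` in the double coset of `b'` (for every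
representative of `Π_{b'}`; the representative only moves `x` inside its double coset).
Hypotheses: the LOCAL description `IsFiniteEtaleCoveringOf A` (the content is vertex-local) and
branch-alignment `IsBranchAligned` (ruling μ2: the branch functors of `𝒢'` are data of `φ` pinned by
the 2-cells only up to a `Π_v`-twist; alignment excludes the twisted junk on which the EQUALITY clause
fails). [cite: MochizukiSemiAnbd2006, Def. 2.2(i) p.23] -/
def covering_branchFibre_doubleCosets : Prop :=
  ∀ (𝒢 𝒢' : SemiGraphOfAnabelioids.{v₁, u₁, u}) (φ : Hom 𝒢' 𝒢) (A : 𝒢.BObj),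
    φ.IsFiniteEtaleCoveringOf A → φ.IsBranchAligned →
    ∀ (v' : 𝒢'.graph.Vertex) (F' : 𝒢'.V v' ⥤ FintypeCat.{v₁}) [FiberFunctor F']
      (F : 𝒢.V (φ.base.vertexMap v') ⥤ FintypeCat.{v₁}) [FiberFunctor F]
      (β : (φ.φV v').pullback ⋙ F' ≅ F)
      (b : 𝒢.graph.Branch) (h : 𝒢.graph.abuts b = some (φ.base.vertexMap v'))
      (Fe : 𝒢.E (𝒢.graph.edgeOf b) ⥤ FintypeCat.{v₁}) [FiberFunctor Fe]
      (α : (𝒢.pull b _ h).pullback ⋙ Fe ≅ F),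
      let ι : 𝒢'.PiV v' F' →* 𝒢.PiV (φ.base.vertexMap v') F :=
        (Aut.autMulEquivOfIso β).toMonoidHom.comp (pi1Map (φ.φV v').pullback F')
      let Pb : Subgroup (Aut F) := 𝒢.branchSubgroup F b h Fe α
      ∃ d : {b' : 𝒢'.graph.Branch // φ.base.branchMap b' = b ∧ 𝒢'.graph.abuts b' = some v'} → Aut F,
        Function.Bijective (fun b' => DoubleCoset.mk ι.range Pb (d b')) ∧
        ∀ (b' : {b' : 𝒢'.graph.Branch // φ.base.branchMap b' = b ∧ 𝒢'.graph.abuts b' = some v'})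
          (Fe' : 𝒢'.E (𝒢'.graph.edgeOf b'.1) ⥤ FintypeCat.{v₁}) [FiberFunctor Fe']
          (α' : (𝒢'.pull b'.1 v' b'.2.2).pullback ⋙ Fe' ≅ F'),
          ∃ x : Aut F, DoubleCoset.mk ι.range Pb x = DoubleCoset.mk ι.range Pb (d b') ∧
            (𝒢'.branchSubgroup F' b'.1 b'.2.2 Fe' α').map ι = ι.range ⊓ ConjAct.toConjAct x • Pb

end SemiGraphOfAnabelioids

end Literature.AnabelianGeometry.SemiGraphs
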